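import Mathlib
import HarnessLib
import Summits.HubbardSuperconductivity.HubbardSuperconductivity.Theorems.KLProgrammeKLRegimeVolumeLimitLastScaleTriangleDoor
import Summits.HubbardSuperconductivity.HubbardSuperconductivity.Theorems.KLProgrammeKLRegimeTwoVolumeLastScaleFrameExact
import Summits.HubbardSuperconductivity.HubbardSuperconductivity.Theorems.KLProgrammeKLRegimeTwoVolumeDualMomentumReadout

/-!
# Route `KLProgramme` — crux K3, VL child `KLRegimeVolumeLimitV17F2` (stmt-HubbardSuperconductivity-20440): THE REGISTERED STUB TEXT FROM THE
# COMMON-FRAME TWO-VOLUME COMPARISON ALONE (the own-frame passage of the fine volume is exact algebra at the last scale)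
# (cell gate-hubbard-kl, seat hubbard-kl-k3c4-p2 g9, technique «Matsubara all-U»: exact covariance / Grassmann identities)

`stub_vl_nestedFramed` compares the last-scale carriers of `L ∣ L″` EACH AT ITS OWN flow frame `K_V = klFlowFrameU V M β U μ (n_β+1)`.  k3c5-p3's triangle door
`framedNestedFlowTextV17F2_of_commonFrame_and_mismatch` (p550636) splits this into (i) a COMMON-FRAME comparison `‖Σ^{K_L}_L(ω,k) − Σ^{K_L}_{L″}(ω,k″)‖ ≤ δ L`
and (ii) a ONE-VOLUME frame-mismatch step `‖Σ^{K_L}_{L″}(ω,k″) − Σ^{K_{L″}}_{L″}(ω,k″)‖ ≤ δ L`.  By `…TwoVolumeLastScaleFrameExact` leg (ii) is EXACT ALGEBRA at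
the reading scale `n_β+1` (`klScale klE0 (n_β+1) < π/β`: the mismatch covariance vanishes): `‖Σ^{K₂} − Σ^{K₁}‖ ≤ |D| + |D|(β/π)(|D| + (2 + |D|β/π)‖Σ^{K₁}‖)`
with `D = K_{L″}(p) − K_L(p)`, `|D| ≤ F/L`, `F = Σ_{m ≤ n_β} Q.CL β m` (`flowFrames_twoVolume_of_towerV17F2`).  Hence:

* **`framedNestedFlowTextV17F2_of_commonFrame_bounded`**: IF, inside the regime binders and under the tower, for every Matsubara integer `n` there are `L₀`,
  `δ → 0` and `B` such that for `L ≥ L₀`, `L ∣ L″`, eventually in the common cutoff, at every label of integer `n` and every pair of momenta with `p_{k″} = p_k`: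
  the undressed last-scale partition function of the FINE volume at the COARSE frame `K_L` is a unit, (i) `‖Σ^{K_L}_L(ω,k) − Σ^{K_L}_{L″}(ω,k″)‖ ≤ δ L`, and
  `‖Σ^{K_L}_L(ω,k)‖ ≤ B` (ONE volume, its own frame), THEN the stub text holds with rate
  `ρ L = δ L + F/L + (F/L)(β/π)(F/L + (2 + (F/L)β/π)(B + δ L)) → 0`;
* `volumeLimitTextV17F2_of_commonFrame_bounded` — hence the VL child text.

So 20440 owes ONLY the common-frame comparison (i) (plus the unit and the one-volume bound, native outputs of the two-volume pass): the (A3) induction may run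
BOTH internal towers at the coarse frame `K_L` (sampled sector families and symbols then coincide — bracket (i) `…TwoVolumeSectorPeriodisation`), with no
per-scale frame bracket.  Proofs only; no definition; nothing asserts superconductivity.  References: BGM 2006 §2.4 (2.38); FST 1996 §1.
-/

noncomputable section

namespace Summit.HubbardSuperconductivity.HubbardSuperconductivity.Theorems.TwoPointAssembly

set_option linter.dupNamespace false -- summit = problem name (single-conjunct summit), D-0017

open Finset Filter Topology Literature.MathematicalPhysics.QuantumLattice Literature.Probability.LatticeModels
open Summit.HubbardSuperconductivity.HubbardSuperconductivity.Theorems.KLRegimeSplit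
open Summit.HubbardSuperconductivity.HubbardSuperconductivity.Theorems.KLProgrammeLegKernels
open Summit.HubbardSuperconductivity.HubbardSuperconductivity.Theorems.TwoVolumeDefect

/-- Rate bookkeeping: `x → 0`, `δ → 0` ⇒ `x + x·c·(x + (2 + x·c)·(B + δ)) → 0`. -/
theorem tendsto_frameRate_zero {x δ : ℕ → ℝ} (hx : Tendsto x atTop (𝓝 0)) (hδ : Tendsto δ atTop (𝓝 0)) (c B : ℝ) :
    Tendsto (fun L => x L + x L * c * (x L + (2 + x L * c) * (B + δ L))) atTop (𝓝 0) := by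
  have h : Tendsto (fun L => x L + x L * c * (x L + (2 + x L * c) * (B + δ L))) atTop
      (𝓝 (0 + 0 * c * (0 + (2 + 0 * c) * (B + 0)))) :=
    hx.add ((hx.mul_const c).mul (hx.add ((tendsto_const_nhds.add (hx.mul_const c)).mul (tendsto_const_nhds.add hδ))))
  simpa using h

/-- Monotonicity of the leg-(ii) majorant `x + x·c·(x + (2 + x·c)·s)` in `x, s ≥ 0` (`c ≥ 0`). -/
theorem frameRate_mono {x x' s s' c : ℝ} (hx : 0 ≤ x) (hxx : x ≤ x') (hs : 0 ≤ s) (hss : s ≤ s') (hc : 0 ≤ c) :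
    x + x * c * (x + (2 + x * c) * s) ≤ x' + x' * c * (x' + (2 + x' * c) * s') := by
  have hx' : 0 ≤ x' := hx.trans hxx
  gcongr

/-- **THE STUB TEXT OF «cauchy v8-F2» FROM THE COMMON-FRAME TWO-VOLUME COMPARISON, A ONE-VOLUME BOUND AND A UNIT PARTITION FUNCTION** — the fine
volume's passage from the coarse frame `K_L` to its own frame `K_{L″}` is exact algebra at the last scale (`norm_klSelfEnergy_frame_sub_le_lastScale`), the frame
mismatch `|K_{L″}(p) − K_L(p)| ≤ (Σ_m Q.CL β m)/L` comes from the tower (`flowFrames_twoVolume_of_towerV17F2`). [cite: BenfattoGiulianiMastropietro2006, §2.4 (2.38)] -/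
theorem framedNestedFlowTextV17F2_of_commonFrame_bounded
    (hC : ∀ (G : GeoConsts) (P : SplitConsts) (Q : EngConsts) (R : RenConsts), G.WF → P.WF → Q.WF → R.WF →
      ∃ c₅ : ℝ, 0 < c₅ ∧ ∀ c : ℝ, 0 < c → c ≤ c₅ → ∃ U₀ : ℝ, 0 < U₀ ∧
        ∀ μ ∈ klWindowC, ∀ U : ℝ, 0 < U → U ≤ U₀ → ∀ β : ℝ, klBetaMin ≤ β → β ≤ Real.exp (c / U ^ 2) →
          ∀ K : TrigPolyC4v, klPredsV17F2.frameOK R U (nScales β) μ K →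
            ∀ (Lstar : ℕ) (Mstar : ℕ → ℕ), TowerP klPredsV17F2 G P Q R β U μ K Lstar Mstar →
              ∀ n : ℤ, ∃ L₀ : ℕ, ∃ δ : ℕ → ℝ, ∃ B : ℝ, Tendsto δ atTop (𝓝 0) ∧
                ∀ (L : ℕ) [NeZero L], L₀ ≤ L → ∀ (L'' : ℕ) [NeZero L''], L ∣ L'' → ∃ M₀ : ℕ, ∀ (M : ℕ) [NeZero M], M₀ ≤ M →
                  ∀ (ω : MatsubaraIdx M), matsubaraInt M ω = n → ∀ (k : TorusSite 2 L) (k'' : TorusSite 2 L''),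
                    latticeMomentum L'' k'' = latticeMomentum L k →
                      IsUnit (effPartitionFn ℂ
                          (normalCovariance L'' M (uvSymbolCT L'' M β μ (klFlowFrameU L M β U μ (nScales β + 1)) (klScale klE0 (nScales β + 1))))
                          (hubbardInteraction L'' M β U + counterQuadratic L'' M β (klFlowFrameU L M β U μ (nScales β + 1)))) ∧
                      ‖klSelfEnergy L M β U μ (klFlowFrameU L M β U μ (nScales β + 1)) klE0 (nScales β + 1) (ω, k) 0 -
                          klSelfEnergy L'' M β U μ (klFlowFrameU L M β U μ (nScales β + 1)) klE0 (nScales β + 1) (ω, k'') 0‖ ≤ δ L ∧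
                      ‖klSelfEnergy L M β U μ (klFlowFrameU L M β U μ (nScales β + 1)) klE0 (nScales β + 1) (ω, k) 0‖ ≤ B) :
    ∀ (G : GeoConsts) (P : SplitConsts) (Q : EngConsts) (R : RenConsts), G.WF → P.WF → Q.WF → R.WF →
      ∃ c₅ : ℝ, 0 < c₅ ∧ ∀ c : ℝ, 0 < c → c ≤ c₅ → ∃ U₀ : ℝ, 0 < U₀ ∧
        ∀ μ ∈ klWindowC, ∀ U : ℝ, 0 < U → U ≤ U₀ → ∀ β : ℝ, klBetaMin ≤ β → β ≤ Real.exp (c / U ^ 2) →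
          ∀ K : TrigPolyC4v, klPredsV17F2.frameOK R U (nScales β) μ K →
            ∀ (Lstar : ℕ) (Mstar : ℕ → ℕ), TowerP klPredsV17F2 G P Q R β U μ K Lstar Mstar →
              ∀ n : ℤ, ∃ L₀ : ℕ, ∃ ρ : ℕ → ℝ, Tendsto ρ atTop (𝓝 0) ∧
                ∀ (L : ℕ) [NeZero L], L₀ ≤ L → ∀ (L'' : ℕ) [NeZero L''], L ∣ L'' → ∃ M₀ : ℕ, ∀ (M : ℕ) [NeZero M], M₀ ≤ M →
                  ∀ (ω : MatsubaraIdx M), matsubaraInt M ω = n → ∀ (k : TorusSite 2 L) (k'' : TorusSite 2 L''),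
                    latticeMomentum L'' k'' = latticeMomentum L k →
                      ‖klSelfEnergy L M β U μ (klFlowFrameU L M β U μ (nScales β + 1)) klE0 (nScales β + 1) (ω, k) 0 -
                          klSelfEnergy L'' M β U μ (klFlowFrameU L'' M β U μ (nScales β + 1)) klE0 (nScales β + 1) (ω, k'') 0‖ ≤ ρ L := by
  intro G P Q R hG hP hQ hR
  obtain ⟨c₅, hc₅, hc⟩ := hC G P Q R hG hP hQ hR
  refine ⟨c₅, hc₅, fun c hc0 hcc => ?_⟩
  obtain ⟨U₀, hU₀, hU⟩ := hc c hc0 hcc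
  refine ⟨U₀, hU₀, fun μ hμ U hU0 hUU β hβmin hβmax K hK Lstar Mstar hT n => ?_⟩
  have hβ : 0 < β := KLRegimeSplit.pos_of_klBetaMin_le hβmin
  obtain ⟨L₀, δ, B, hδ, hCn⟩ := hU μ hμ U hU0 hUU β hβmin hβmax K hK Lstar Mstar hT n
  -- the frame-mismatch constant and the rate
  set F : ℝ := ∑ m ∈ Finset.range (nScales β + 1), Q.CL β m with hFdef
  set x : ℕ → ℝ := fun L => F / (L : ℝ) with hxdef
  have hx : Tendsto x atTop (𝓝 0) := tendsto_const_div_atTop_nhds_zero_nat F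
  refine ⟨max L₀ Lstar, fun L => δ L + (x L + x L * (β / Real.pi) * (x L + (2 + x L * (β / Real.pi)) * (B + δ L))),
    by simpa using hδ.add (tendsto_frameRate_zero hx hδ (β / Real.pi) B), fun L _ hL L'' _ hdvd => ?_⟩
  have hL₀ : L₀ ≤ L := (le_max_left _ _).trans hL
  have hLs : Lstar ≤ L := (le_max_right _ _).trans hL
  have hLL'' : L ≤ L'' := Nat.le_of_dvd (Nat.pos_of_ne_zero (NeZero.ne L'')) hdvd
  obtain ⟨M₀, hM₀⟩ := hCn L hL₀ L'' hdvd
  refine ⟨max M₀ (max (max (Mstar L) (Mstar L'')) (max (Q.M0 β L) (Q.M0 β L''))), fun M _ hM ω hω k k'' hk => ?_⟩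
  have hMM₀ : M₀ ≤ M := (le_max_left _ _).trans hM
  have hM₁ : Mstar L ≤ M := ((le_max_left _ _).trans (le_max_left _ _)).trans ((le_max_right _ _).trans hM)
  have hM₁' : Mstar L'' ≤ M := ((le_max_right _ _).trans (le_max_left _ _)).trans ((le_max_right _ _).trans hM)
  have hM₂ : Q.M0 β L ≤ M := ((le_max_left _ _).trans (le_max_right _ _)).trans ((le_max_right _ _).trans hM)
  have hM₂' : Q.M0 β L'' ≤ M := ((le_max_right _ _).trans (le_max_right _ _)).trans ((le_max_right _ _).trans hM)
  obtain ⟨hZ, h1, hB⟩ := hM₀ M hMM₀ ω hω k k'' hk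
  -- leg (ii): exact algebra at the last scale, volume `L″`, frames `K_L` (= `K₁`) and `K_{L″}` (= `K₂`)
  have h2 := norm_klSelfEnergy_frame_sub_le_lastScale (L := L'') hβ U μ
    (klFlowFrameU L M β U μ (nScales β + 1)) (klFlowFrameU L'' M β U μ (nScales β + 1)) hZ ω k'' 0
  -- the frame mismatch at the reading momentum
  have hD : |(fsub (klFlowFrameU L'' M β U μ (nScales β + 1)) (klFlowFrameU L M β U μ (nScales β + 1))).eval (latticeMomentum L'' k'')| ≤ x L := by
    rw [eval_fsub, abs_sub_comm]
    exact flowFrames_twoVolume_of_towerV17F2 hμ hT hLs hLL'' hM₁ hM₂ hM₁' hM₂' le_rfl _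
  -- the fine volume's coarse-frame carrier is bounded by the coarse one plus (i)
  have hS : ‖klSelfEnergy L'' M β U μ (klFlowFrameU L M β U μ (nScales β + 1)) klE0 (nScales β + 1) (ω, k'') 0‖ ≤ B + δ L := by
    have := norm_sub_le_norm_sub_add_norm_sub (0 : ℂ)
      (klSelfEnergy L M β U μ (klFlowFrameU L M β U μ (nScales β + 1)) klE0 (nScales β + 1) (ω, k) 0)
      (klSelfEnergy L'' M β U μ (klFlowFrameU L M β U μ (nScales β + 1)) klE0 (nScales β + 1) (ω, k'') 0)
    rw [zero_sub, norm_neg, zero_sub, norm_neg] at this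
    exact this.trans (add_le_add hB h1)
  have hleg : ‖klSelfEnergy L'' M β U μ (klFlowFrameU L M β U μ (nScales β + 1)) klE0 (nScales β + 1) (ω, k'') 0 -
      klSelfEnergy L'' M β U μ (klFlowFrameU L'' M β U μ (nScales β + 1)) klE0 (nScales β + 1) (ω, k'') 0‖ ≤
      x L + x L * (β / Real.pi) * (x L + (2 + x L * (β / Real.pi)) * (B + δ L)) := by
    rw [norm_sub_rev]
    exact h2.trans (frameRate_mono (abs_nonneg _) hD (norm_nonneg _) hS (by positivity))
  exact (norm_sub_le_norm_sub_add_norm_sub _ _ _).trans (add_le_add h1 hleg)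

/-- **The VL child text from the common-frame comparison** (∘ `volumeLimitTextV17F2_of_framedNestedFlowText`). [cite: BenfattoGiulianiMastropietro2006, §2.4 (2.38)] -/
theorem volumeLimitTextV17F2_of_commonFrame_bounded
    (hC : ∀ (G : GeoConsts) (P : SplitConsts) (Q : EngConsts) (R : RenConsts), G.WF → P.WF → Q.WF → R.WF →
      ∃ c₅ : ℝ, 0 < c₅ ∧ ∀ c : ℝ, 0 < c → c ≤ c₅ → ∃ U₀ : ℝ, 0 < U₀ ∧
        ∀ μ ∈ klWindowC, ∀ U : ℝ, 0 < U → U ≤ U₀ → ∀ β : ℝ, klBetaMin ≤ β → β ≤ Real.exp (c / U ^ 2) →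
          ∀ K : TrigPolyC4v, klPredsV17F2.frameOK R U (nScales β) μ K →
            ∀ (Lstar : ℕ) (Mstar : ℕ → ℕ), TowerP klPredsV17F2 G P Q R β U μ K Lstar Mstar →
              ∀ n : ℤ, ∃ L₀ : ℕ, ∃ δ : ℕ → ℝ, ∃ B : ℝ, Tendsto δ atTop (𝓝 0) ∧
                ∀ (L : ℕ) [NeZero L], L₀ ≤ L → ∀ (L'' : ℕ) [NeZero L''], L ∣ L'' → ∃ M₀ : ℕ, ∀ (M : ℕ) [NeZero M], M₀ ≤ M →
                  ∀ (ω : MatsubaraIdx M), matsubaraInt M ω = n → ∀ (k : TorusSite 2 L) (k'' : TorusSite 2 L''),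
                    latticeMomentum L'' k'' = latticeMomentum L k →
                      IsUnit (effPartitionFn ℂ
                          (normalCovariance L'' M (uvSymbolCT L'' M β μ (klFlowFrameU L M β U μ (nScales β + 1)) (klScale klE0 (nScales β + 1))))
                          (hubbardInteraction L'' M β U + counterQuadratic L'' M β (klFlowFrameU L M β U μ (nScales β + 1)))) ∧
                      ‖klSelfEnergy L M β U μ (klFlowFrameU L M β U μ (nScales β + 1)) klE0 (nScales β + 1) (ω, k) 0 -
                          klSelfEnergy L'' M β U μ (klFlowFrameU L M β U μ (nScales β + 1)) klE0 (nScales β + 1) (ω, k'') 0‖ ≤ δ L ∧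
                      ‖klSelfEnergy L M β U μ (klFlowFrameU L M β U μ (nScales β + 1)) klE0 (nScales β + 1) (ω, k) 0‖ ≤ B) :
    VolumeLimitP2 klPredsV17F2 FinalTwoLegVolLimitEx klWindowC :=
  volumeLimitTextV17F2_of_framedNestedFlowText (framedNestedFlowTextV17F2_of_commonFrame_bounded hC)

/-! ### Appended (g9, same session): THE SAME DOOR READ IN DUAL-LATTICE CURRENCY — the leanest end door for a common-frame (A3)

k3c5-p3's dual read-out `norm_klSelfEnergy_sub_le_frame_add_dualDefect` (ANY two frames, any pins) at `K_c = K_f := K_L` has NO frame term, and its output is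
exactly hypothesis (i) above.  So: stub text ⟸ «for `L ≥ L₀`, `L″ = b·L`, eventually in `M`: `IsUnit Z_{L″}^{n⋆}(K_L)` ∧ ∃ pins `o_c, o_f` with, at every label of
integer `n`, `2ε·(Ddef₊ + Dfar₊) ≤ δ L` for the rows of `G_L = T_L(K_L) − 𝒩_{K_L}` and `G″ = T_{L″}(K_L) − 𝒩_{K_L}` (BOTH at the coarse frame) ∧
`‖Σ^{K_L}_L(ω,k)‖ ≤ B` at every momentum» (compare k3c5-p3's `framedNestedFlowTextV17F2_of_commonFrameDualDefect_and_frameChange`, p554338, which keeps leg (ii)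
as a hypothesis). -/

open Complex GrassmannAlgebra

/-- **THE STUB TEXT OF «cauchy v8-F2» FROM THE LAST-SCALE PINNED ROW DEFECT AT THE COMMON FRAME (dual currency).**  See the module docstring;
`ε = imagTimeWeight β M`, `K_L = klFlowFrameU L M β U μ (n_β+1)` used on BOTH tori, `G_V = klEffectiveAction V M β U μ K_L klE0 (n_β+1) − counterQuadratic V M β K_L`,
rows `R_V(o;y) = Σ_{t₁} W_{G_V}(o,(t₁,o⃗+y))·e^{iω(t_o−t₁)}`, `ȳ↑ = proj (cRep ȳ)`. [cite: BenfattoGiulianiMastropietro2006, §2.4 (2.38)] -/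
theorem framedNestedFlowTextV17F2_of_commonFrameDualDefectText
    (hD : ∀ (G : GeoConsts) (P : SplitConsts) (Q : EngConsts) (R : RenConsts), G.WF → P.WF → Q.WF → R.WF →
      ∃ c₅ : ℝ, 0 < c₅ ∧ ∀ c : ℝ, 0 < c → c ≤ c₅ → ∃ U₀ : ℝ, 0 < U₀ ∧
        ∀ μ ∈ klWindowC, ∀ U : ℝ, 0 < U → U ≤ U₀ → ∀ β : ℝ, klBetaMin ≤ β → β ≤ Real.exp (c / U ^ 2) →
          ∀ K : TrigPolyC4v, klPredsV17F2.frameOK R U (nScales β) μ K →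
            ∀ (Lstar : ℕ) (Mstar : ℕ → ℕ), TowerP klPredsV17F2 G P Q R β U μ K Lstar Mstar →
              ∀ n : ℤ, ∃ L₀ : ℕ, ∃ δ : ℕ → ℝ, ∃ B : ℝ, Tendsto δ atTop (𝓝 0) ∧
                ∀ (L : ℕ) [NeZero L], L₀ ≤ L → ∀ (L'' : ℕ) [NeZero L''] (b : ℕ), L'' = b * L → ∃ M₀ : ℕ, ∀ (M : ℕ) [NeZero M], M₀ ≤ M →
                  IsUnit (effPartitionFn ℂ
                      (normalCovariance L'' M (uvSymbolCT L'' M β μ (klFlowFrameU L M β U μ (nScales β + 1)) (klScale klE0 (nScales β + 1))))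
                      (hubbardInteraction L'' M β U + counterQuadratic L'' M β (klFlowFrameU L M β U μ (nScales β + 1)))) ∧
                  ∃ (oc : SpaceTimeIdx L M) (of : SpaceTimeIdx L'' M), ∀ ω : MatsubaraIdx M, matsubaraInt M ω = n →
                    2 * imagTimeWeight β M *
                      ((∑ ybar : TorusSite 2 L,
                          ‖(∑ t₁ : ImagTimeIdx M,
                              sectorisedKernel L M β (trivialMultiplier L M)
                                  (klEffectiveAction L M β U μ (klFlowFrameU L M β U μ (nScales β + 1)) klE0 (nScales β + 1) -
                                    counterQuadratic L M β (klFlowFrameU L M β U μ (nScales β + 1))) 2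
                                  (![((0, 0), 0), ((0, 0), 1)] : Fin 2 → SectorLeg 1) ![oc, (t₁, oc.2 + ybar)] *
                                Complex.exp (((matsubaraFreq β M ω * (imagTime β M oc.1 - imagTime β M t₁) : ℝ) : ℂ) * I)) -
                            (∑ t₁ : ImagTimeIdx M,
                              sectorisedKernel L'' M β (trivialMultiplier L'' M)
                                  (klEffectiveAction L'' M β U μ (klFlowFrameU L M β U μ (nScales β + 1)) klE0 (nScales β + 1) -
                                    counterQuadratic L'' M β (klFlowFrameU L M β U μ (nScales β + 1))) 2
                                  (![((0, 0), 0), ((0, 0), 1)] : Fin 2 → SectorLeg 1) ![of, (t₁, of.2 + Torus.proj L'' (Torus.cRep ybar))] *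
                                Complex.exp (((matsubaraFreq β M ω * (imagTime β M of.1 - imagTime β M t₁) : ℝ) : ℂ) * I))‖) +
                        ∑ y ∈ univ.filter (fun y : TorusSite 2 L'' => Torus.proj L'' (Torus.cRep (fun i => (((y i).val : ℕ) : ZMod L))) ≠ y),
                          ‖∑ t₁ : ImagTimeIdx M,
                              sectorisedKernel L'' M β (trivialMultiplier L'' M)
                                  (klEffectiveAction L'' M β U μ (klFlowFrameU L M β U μ (nScales β + 1)) klE0 (nScales β + 1) -
                                    counterQuadratic L'' M β (klFlowFrameU L M β U μ (nScales β + 1))) 2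
                                  (![((0, 0), 0), ((0, 0), 1)] : Fin 2 → SectorLeg 1) ![of, (t₁, of.2 + y)] *
                                Complex.exp (((matsubaraFreq β M ω * (imagTime β M of.1 - imagTime β M t₁) : ℝ) : ℂ) * I)‖) ≤ δ L ∧
                    ∀ k : TorusSite 2 L,
                      ‖klSelfEnergy L M β U μ (klFlowFrameU L M β U μ (nScales β + 1)) klE0 (nScales β + 1) (ω, k) 0‖ ≤ B) :
    ∀ (G : GeoConsts) (P : SplitConsts) (Q : EngConsts) (R : RenConsts), G.WF → P.WF → Q.WF → R.WF →
      ∃ c₅ : ℝ, 0 < c₅ ∧ ∀ c : ℝ, 0 < c → c ≤ c₅ → ∃ U₀ : ℝ, 0 < U₀ ∧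
        ∀ μ ∈ klWindowC, ∀ U : ℝ, 0 < U → U ≤ U₀ → ∀ β : ℝ, klBetaMin ≤ β → β ≤ Real.exp (c / U ^ 2) →
          ∀ K : TrigPolyC4v, klPredsV17F2.frameOK R U (nScales β) μ K →
            ∀ (Lstar : ℕ) (Mstar : ℕ → ℕ), TowerP klPredsV17F2 G P Q R β U μ K Lstar Mstar →
              ∀ n : ℤ, ∃ L₀ : ℕ, ∃ ρ : ℕ → ℝ, Tendsto ρ atTop (𝓝 0) ∧
                ∀ (L : ℕ) [NeZero L], L₀ ≤ L → ∀ (L'' : ℕ) [NeZero L''], L ∣ L'' → ∃ M₀ : ℕ, ∀ (M : ℕ) [NeZero M], M₀ ≤ M →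
                  ∀ (ω : MatsubaraIdx M), matsubaraInt M ω = n → ∀ (k : TorusSite 2 L) (k'' : TorusSite 2 L''),
                    latticeMomentum L'' k'' = latticeMomentum L k →
                      ‖klSelfEnergy L M β U μ (klFlowFrameU L M β U μ (nScales β + 1)) klE0 (nScales β + 1) (ω, k) 0 -
                          klSelfEnergy L'' M β U μ (klFlowFrameU L'' M β U μ (nScales β + 1)) klE0 (nScales β + 1) (ω, k'') 0‖ ≤ ρ L := by
  -- repackage `hD` as the hypothesis of `framedNestedFlowTextV17F2_of_commonFrame_bounded`: the dual read-out at the COMMON frame has no frame term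
  refine framedNestedFlowTextV17F2_of_commonFrame_bounded fun G P Q R hG hP hQ hR => ?_
  obtain ⟨c₅, hc₅, hc⟩ := hD G P Q R hG hP hQ hR
  refine ⟨c₅, hc₅, fun c hc0 hcc => ?_⟩
  obtain ⟨U₀, hU₀, hU⟩ := hc c hc0 hcc
  refine ⟨U₀, hU₀, fun μ hμ U hU0 hUU β hβmin hβmax K hK Lstar Mstar hT n => ?_⟩
  have hβ : 0 < β := KLRegimeSplit.pos_of_klBetaMin_le hβmin
  obtain ⟨L₀, δ, B, hδ, hDn⟩ := hU μ hμ U hU0 hUU β hβmin hβmax K hK Lstar Mstar hT n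
  refine ⟨L₀, δ, B, hδ, fun L _ hL L'' _ hdvd => ?_⟩
  obtain ⟨b, hb⟩ := hdvd
  have hb' : L'' = b * L := by rw [hb, mul_comm]
  obtain ⟨M₀, hM₀⟩ := hDn L hL L'' b hb'
  refine ⟨M₀, fun M _ hM ω hω k k'' hk => ?_⟩
  obtain ⟨hZ, oc, of, hw⟩ := hM₀ M hM
  obtain ⟨hDef, hB⟩ := hw ω hω
  refine ⟨hZ, ?_, hB k⟩
  have h := norm_klSelfEnergy_sub_le_frame_add_dualDefect hb' hβ U μ
    (klFlowFrameU L M β U μ (nScales β + 1)) (klFlowFrameU L M β U μ (nScales β + 1)) (nScales β + 1) ω 0 oc of hk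
  rw [sub_self, abs_zero, zero_add] at h
  exact h.trans hDef

/-- **The VL child text from the last-scale pinned row defect at the common frame** (∘ `volumeLimitTextV17F2_of_framedNestedFlowText`).
[cite: BenfattoGiulianiMastropietro2006, §2.4 (2.38)] -/
theorem volumeLimitTextV17F2_of_commonFrameDualDefectText
    (hD : ∀ (G : GeoConsts) (P : SplitConsts) (Q : EngConsts) (R : RenConsts), G.WF → P.WF → Q.WF → R.WF →
      ∃ c₅ : ℝ, 0 < c₅ ∧ ∀ c : ℝ, 0 < c → c ≤ c₅ → ∃ U₀ : ℝ, 0 < U₀ ∧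
        ∀ μ ∈ klWindowC, ∀ U : ℝ, 0 < U → U ≤ U₀ → ∀ β : ℝ, klBetaMin ≤ β → β ≤ Real.exp (c / U ^ 2) →
          ∀ K : TrigPolyC4v, klPredsV17F2.frameOK R U (nScales β) μ K →
            ∀ (Lstar : ℕ) (Mstar : ℕ → ℕ), TowerP klPredsV17F2 G P Q R β U μ K Lstar Mstar →
              ∀ n : ℤ, ∃ L₀ : ℕ, ∃ δ : ℕ → ℝ, ∃ B : ℝ, Tendsto δ atTop (𝓝 0) ∧
                ∀ (L : ℕ) [NeZero L], L₀ ≤ L → ∀ (L'' : ℕ) [NeZero L''] (b : ℕ), L'' = b * L → ∃ M₀ : ℕ, ∀ (M : ℕ) [NeZero M], M₀ ≤ M →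
                  IsUnit (effPartitionFn ℂ
                      (normalCovariance L'' M (uvSymbolCT L'' M β μ (klFlowFrameU L M β U μ (nScales β + 1)) (klScale klE0 (nScales β + 1))))
                      (hubbardInteraction L'' M β U + counterQuadratic L'' M β (klFlowFrameU L M β U μ (nScales β + 1)))) ∧
                  ∃ (oc : SpaceTimeIdx L M) (of : SpaceTimeIdx L'' M), ∀ ω : MatsubaraIdx M, matsubaraInt M ω = n →
                    2 * imagTimeWeight β M *
                      ((∑ ybar : TorusSite 2 L,
                          ‖(∑ t₁ : ImagTimeIdx M,
                              sectorisedKernel L M β (trivialMultiplier L M)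
                                  (klEffectiveAction L M β U μ (klFlowFrameU L M β U μ (nScales β + 1)) klE0 (nScales β + 1) -
                                    counterQuadratic L M β (klFlowFrameU L M β U μ (nScales β + 1))) 2
                                  (![((0, 0), 0), ((0, 0), 1)] : Fin 2 → SectorLeg 1) ![oc, (t₁, oc.2 + ybar)] *
                                Complex.exp (((matsubaraFreq β M ω * (imagTime β M oc.1 - imagTime β M t₁) : ℝ) : ℂ) * I)) -
                            (∑ t₁ : ImagTimeIdx M,
                              sectorisedKernel L'' M β (trivialMultiplier L'' M)
                                  (klEffectiveAction L'' M β U μ (klFlowFrameU L M β U μ (nScales β + 1)) klE0 (nScales β + 1) -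
                                    counterQuadratic L'' M β (klFlowFrameU L M β U μ (nScales β + 1))) 2
                                  (![((0, 0), 0), ((0, 0), 1)] : Fin 2 → SectorLeg 1) ![of, (t₁, of.2 + Torus.proj L'' (Torus.cRep ybar))] *
                                Complex.exp (((matsubaraFreq β M ω * (imagTime β M of.1 - imagTime β M t₁) : ℝ) : ℂ) * I))‖) +
                        ∑ y ∈ univ.filter (fun y : TorusSite 2 L'' => Torus.proj L'' (Torus.cRep (fun i => (((y i).val : ℕ) : ZMod L))) ≠ y),
                          ‖∑ t₁ : ImagTimeIdx M,
                              sectorisedKernel L'' M β (trivialMultiplier L'' M)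
                                  (klEffectiveAction L'' M β U μ (klFlowFrameU L M β U μ (nScales β + 1)) klE0 (nScales β + 1) -
                                    counterQuadratic L'' M β (klFlowFrameU L M β U μ (nScales β + 1))) 2
                                  (![((0, 0), 0), ((0, 0), 1)] : Fin 2 → SectorLeg 1) ![of, (t₁, of.2 + y)] *
                                Complex.exp (((matsubaraFreq β M ω * (imagTime β M of.1 - imagTime β M t₁) : ℝ) : ℂ) * I)‖) ≤ δ L ∧
                    ∀ k : TorusSite 2 L,
                      ‖klSelfEnergy L M β U μ (klFlowFrameU L M β U μ (nScales β + 1)) klE0 (nScales β + 1) (ω, k) 0‖ ≤ B) :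
    VolumeLimitP2 klPredsV17F2 FinalTwoLegVolLimitEx klWindowC :=
  volumeLimitTextV17F2_of_framedNestedFlowText (framedNestedFlowTextV17F2_of_commonFrameDualDefectText hD)

/-! ### Appended (g9, same session): the one-volume bound `B` discharged from the coarse volume's dual rows and the tower's frame bound -/

/-- **One-volume size of the last-scale carrier from its dual rows and the tower's frame bound**:
`‖Σ^{K_L}_L(ω,k)‖ ≤ Σ_{m ≤ n_β} R.Gfr 0·uPow 0 U·4^{−2m} + 2ε·Σ_y ‖R_L(o;y)‖` (`Σ[𝒱[K]](k) = K(p_k⃗) + Σ[𝒱[K] − 𝒩_K](k)`, `|K_L(p)|` from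
`abs_eval_klFlowFrameU_le_of_towerV17F2`, the rest from k3c5-p3's `norm_selfEnergy_le_dualRows`). [cite: BenfattoGiulianiMastropietro2006, §2.1 (2.5)] -/
theorem norm_klSelfEnergy_lastScale_le_frame_add_dualRows {G : GeoConsts} {P : SplitConsts} {Q : EngConsts} {R : RenConsts} {β U μ : ℝ}
    {K₀ : TrigPolyC4v} {Lstar : ℕ} {Mstar : ℕ → ℕ} (hβ : 0 < β) (hT : TowerP klPredsV17F2 G P Q R β U μ K₀ Lstar Mstar)
    {L : ℕ} [NeZero L] (hL : Lstar ≤ L) {M : ℕ} [NeZero M] (hM : Mstar L ≤ M) (ω : MatsubaraIdx M) (σ : Fin 2)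
    (o : SpaceTimeIdx L M) (k : TorusSite 2 L) :
    ‖klSelfEnergy L M β U μ (klFlowFrameU L M β U μ (nScales β + 1)) klE0 (nScales β + 1) (ω, k) σ‖ ≤
      (∑ m ∈ Finset.range (nScales β + 1), R.Gfr 0 * uPow 0 U * (4 : ℝ) ^ ((((0 : ℕ) : ℤ) - 2) * (m : ℤ))) +
        2 * imagTimeWeight β M * ∑ y : TorusSite 2 L,
          ‖∑ t₁ : ImagTimeIdx M,
              sectorisedKernel L M β (trivialMultiplier L M)
                  (klEffectiveAction L M β U μ (klFlowFrameU L M β U μ (nScales β + 1)) klE0 (nScales β + 1) -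
                    counterQuadratic L M β (klFlowFrameU L M β U μ (nScales β + 1))) 2
                  (![((0, σ), 0), ((0, σ), 1)] : Fin 2 → SectorLeg 1) ![o, (t₁, o.2 + y)] *
                Complex.exp (((matsubaraFreq β M ω * (imagTime β M o.1 - imagTime β M t₁) : ℝ) : ℂ) * I)‖ := by
  rw [klSelfEnergy_eq_eval_add_selfEnergy_sub_counter hβ.ne' U μ _ (nScales β + 1) (ω, k) σ]
  refine (norm_add_le _ _).trans (add_le_add ?_ ?_)
  · rw [Complex.norm_real, Real.norm_eq_abs]
    exact abs_eval_klFlowFrameU_le_of_towerV17F2 hT hL hM le_rfl _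
  · exact norm_selfEnergy_le_dualRows hβ _ ω σ
      (rows_baseIndependent_klEffectiveAction_sub_counter hβ.ne' U μ _ (nScales β + 1) ω σ) o k

/-- **THE STUB TEXT OF «cauchy v8-F2» FROM DUAL-ROW DATA AT THE COMMON FRAME ONLY**: as `framedNestedFlowTextV17F2_of_commonFrameDualDefectText`, with the
one-volume self-energy bound replaced by a bound `2ε·Σ_y ‖R_L(o_c;y)‖ ≤ B` on the COARSE volume's dual rows at the same pin (the frame value `|K_L(p)|` is
bounded by the tower) — every hypothesis is now a native output of a common-frame two-volume pass in dual currency plus the unit partition function.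
[cite: BenfattoGiulianiMastropietro2006, §2.4 (2.38)] -/
theorem framedNestedFlowTextV17F2_of_commonFrameDualRowsText
    (hD : ∀ (G : GeoConsts) (P : SplitConsts) (Q : EngConsts) (R : RenConsts), G.WF → P.WF → Q.WF → R.WF →
      ∃ c₅ : ℝ, 0 < c₅ ∧ ∀ c : ℝ, 0 < c → c ≤ c₅ → ∃ U₀ : ℝ, 0 < U₀ ∧
        ∀ μ ∈ klWindowC, ∀ U : ℝ, 0 < U → U ≤ U₀ → ∀ β : ℝ, klBetaMin ≤ β → β ≤ Real.exp (c / U ^ 2) →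
          ∀ K : TrigPolyC4v, klPredsV17F2.frameOK R U (nScales β) μ K →
            ∀ (Lstar : ℕ) (Mstar : ℕ → ℕ), TowerP klPredsV17F2 G P Q R β U μ K Lstar Mstar →
              ∀ n : ℤ, ∃ L₀ : ℕ, ∃ δ : ℕ → ℝ, ∃ B : ℝ, Tendsto δ atTop (𝓝 0) ∧
                ∀ (L : ℕ) [NeZero L], L₀ ≤ L → ∀ (L'' : ℕ) [NeZero L''] (b : ℕ), L'' = b * L → ∃ M₀ : ℕ, ∀ (M : ℕ) [NeZero M], M₀ ≤ M →
                  IsUnit (effPartitionFn ℂ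
                      (normalCovariance L'' M (uvSymbolCT L'' M β μ (klFlowFrameU L M β U μ (nScales β + 1)) (klScale klE0 (nScales β + 1))))
                      (hubbardInteraction L'' M β U + counterQuadratic L'' M β (klFlowFrameU L M β U μ (nScales β + 1)))) ∧
                  ∃ (oc : SpaceTimeIdx L M) (of : SpaceTimeIdx L'' M), ∀ ω : MatsubaraIdx M, matsubaraInt M ω = n →
                    2 * imagTimeWeight β M *
                      ((∑ ybar : TorusSite 2 L,
                          ‖(∑ t₁ : ImagTimeIdx M,
                              sectorisedKernel L M β (trivialMultiplier L M)
                                  (klEffectiveAction L M β U μ (klFlowFrameU L M β U μ (nScales β + 1)) klE0 (nScales β + 1) -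
                                    counterQuadratic L M β (klFlowFrameU L M β U μ (nScales β + 1))) 2
                                  (![((0, 0), 0), ((0, 0), 1)] : Fin 2 → SectorLeg 1) ![oc, (t₁, oc.2 + ybar)] *
                                Complex.exp (((matsubaraFreq β M ω * (imagTime β M oc.1 - imagTime β M t₁) : ℝ) : ℂ) * I)) -
                            (∑ t₁ : ImagTimeIdx M,
                              sectorisedKernel L'' M β (trivialMultiplier L'' M)
                                  (klEffectiveAction L'' M β U μ (klFlowFrameU L M β U μ (nScales β + 1)) klE0 (nScales β + 1) -
                                    counterQuadratic L'' M β (klFlowFrameU L M β U μ (nScales β + 1))) 2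
                                  (![((0, 0), 0), ((0, 0), 1)] : Fin 2 → SectorLeg 1) ![of, (t₁, of.2 + Torus.proj L'' (Torus.cRep ybar))] *
                                Complex.exp (((matsubaraFreq β M ω * (imagTime β M of.1 - imagTime β M t₁) : ℝ) : ℂ) * I))‖) +
                        ∑ y ∈ univ.filter (fun y : TorusSite 2 L'' => Torus.proj L'' (Torus.cRep (fun i => (((y i).val : ℕ) : ZMod L))) ≠ y),
                          ‖∑ t₁ : ImagTimeIdx M,
                              sectorisedKernel L'' M β (trivialMultiplier L'' M)
                                  (klEffectiveAction L'' M β U μ (klFlowFrameU L M β U μ (nScales β + 1)) klE0 (nScales β + 1) -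
                                    counterQuadratic L'' M β (klFlowFrameU L M β U μ (nScales β + 1))) 2
                                  (![((0, 0), 0), ((0, 0), 1)] : Fin 2 → SectorLeg 1) ![of, (t₁, of.2 + y)] *
                                Complex.exp (((matsubaraFreq β M ω * (imagTime β M of.1 - imagTime β M t₁) : ℝ) : ℂ) * I)‖) ≤ δ L ∧
                    2 * imagTimeWeight β M * ∑ y : TorusSite 2 L,
                      ‖∑ t₁ : ImagTimeIdx M,
                          sectorisedKernel L M β (trivialMultiplier L M)
                              (klEffectiveAction L M β U μ (klFlowFrameU L M β U μ (nScales β + 1)) klE0 (nScales β + 1) -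
                                counterQuadratic L M β (klFlowFrameU L M β U μ (nScales β + 1))) 2
                              (![((0, 0), 0), ((0, 0), 1)] : Fin 2 → SectorLeg 1) ![oc, (t₁, oc.2 + y)] *
                            Complex.exp (((matsubaraFreq β M ω * (imagTime β M oc.1 - imagTime β M t₁) : ℝ) : ℂ) * I)‖ ≤ B) :
    ∀ (G : GeoConsts) (P : SplitConsts) (Q : EngConsts) (R : RenConsts), G.WF → P.WF → Q.WF → R.WF →
      ∃ c₅ : ℝ, 0 < c₅ ∧ ∀ c : ℝ, 0 < c → c ≤ c₅ → ∃ U₀ : ℝ, 0 < U₀ ∧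
        ∀ μ ∈ klWindowC, ∀ U : ℝ, 0 < U → U ≤ U₀ → ∀ β : ℝ, klBetaMin ≤ β → β ≤ Real.exp (c / U ^ 2) →
          ∀ K : TrigPolyC4v, klPredsV17F2.frameOK R U (nScales β) μ K →
            ∀ (Lstar : ℕ) (Mstar : ℕ → ℕ), TowerP klPredsV17F2 G P Q R β U μ K Lstar Mstar →
              ∀ n : ℤ, ∃ L₀ : ℕ, ∃ ρ : ℕ → ℝ, Tendsto ρ atTop (𝓝 0) ∧
                ∀ (L : ℕ) [NeZero L], L₀ ≤ L → ∀ (L'' : ℕ) [NeZero L''], L ∣ L'' → ∃ M₀ : ℕ, ∀ (M : ℕ) [NeZero M], M₀ ≤ M →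
                  ∀ (ω : MatsubaraIdx M), matsubaraInt M ω = n → ∀ (k : TorusSite 2 L) (k'' : TorusSite 2 L''),
                    latticeMomentum L'' k'' = latticeMomentum L k →
                      ‖klSelfEnergy L M β U μ (klFlowFrameU L M β U μ (nScales β + 1)) klE0 (nScales β + 1) (ω, k) 0 -
                          klSelfEnergy L'' M β U μ (klFlowFrameU L'' M β U μ (nScales β + 1)) klE0 (nScales β + 1) (ω, k'') 0‖ ≤ ρ L := by
  -- repackage `hD` as the hypothesis of `framedNestedFlowTextV17F2_of_commonFrameDualDefectText` with `B ↦ (frame bound) + B`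
  refine framedNestedFlowTextV17F2_of_commonFrameDualDefectText fun G P Q R hG hP hQ hR => ?_
  obtain ⟨c₅, hc₅, hc⟩ := hD G P Q R hG hP hQ hR
  refine ⟨c₅, hc₅, fun c hc0 hcc => ?_⟩
  obtain ⟨U₀, hU₀, hU⟩ := hc c hc0 hcc
  refine ⟨U₀, hU₀, fun μ hμ U hU0 hUU β hβmin hβmax K hK Lstar Mstar hT n => ?_⟩
  have hβ : 0 < β := KLRegimeSplit.pos_of_klBetaMin_le hβmin
  obtain ⟨L₀, δ, B, hδ, hDn⟩ := hU μ hμ U hU0 hUU β hβmin hβmax K hK Lstar Mstar hT n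
  refine ⟨max L₀ Lstar, δ, (∑ m ∈ Finset.range (nScales β + 1), R.Gfr 0 * uPow 0 U * (4 : ℝ) ^ ((((0 : ℕ) : ℤ) - 2) * (m : ℤ))) + B,
    hδ, fun L _ hL L'' _ b hb => ?_⟩
  have hL₀ : L₀ ≤ L := (le_max_left _ _).trans hL
  have hLs : Lstar ≤ L := (le_max_right _ _).trans hL
  obtain ⟨M₀, hM₀⟩ := hDn L hL₀ L'' b hb
  refine ⟨max M₀ (Mstar L), fun M _ hM => ?_⟩
  have hMM₀ : M₀ ≤ M := (le_max_left _ _).trans hM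
  have hMs : Mstar L ≤ M := (le_max_right _ _).trans hM
  obtain ⟨hZ, oc, of, hw⟩ := hM₀ M hMM₀
  refine ⟨hZ, oc, of, fun ω hω => ?_⟩
  obtain ⟨hDef, hB⟩ := hw ω hω
  exact ⟨hDef, fun k => (norm_klSelfEnergy_lastScale_le_frame_add_dualRows hβ hT hLs hMs ω 0 oc k).trans (by gcongr)⟩

end Summit.HubbardSuperconductivity.HubbardSuperconductivity.Theorems.TwoPointAssembly

end
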